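import Summits.QuantumFields.YangMills.Theorems.BalabanUVNodesN13NormalisationSharpLowerSlopeThresholdAtRecord13SepCoPHV
import Summits.QuantumFields.YangMills.Theorems.BalabanUVNodesK2R9Holds

/-!
# BalabanUVNodes ∕ N13 — K1⁹'s WITNESS HAS NORMALISATION SLOPE EXACTLY d(𝔤)∕4: the body of `StabilityBRunRowsAtRecordR13SepCoPHV` (stmt-QuantumFields-27364) at a tuple whose numerics slots have
# TWO-SIDED log-slope `a` (and K-uniform last-step small-field floors) forces `4a = d(𝔤)` — rows (i) and (iv) of the body supply the coupling comparability both ways, K2⁹ supplies END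

(Track A, DAG node N13 = [B16]; cluster K1 — helper for K1⁹ stmt-QuantumFields-27364; seat `pub-ymgap-dag-n13-w3` g6, INTENT-7; 2026-08-28; count-neutral; theses cone: imports
`…Theorems.BalabanUVNodesK2R9Holds`.)  Cone-side reading of `…N13NormalisationSharpLowerSlopeThresholdAtRecord13SepCoPHV` (INTENT-6) with p648246 (INTENT-5).
* §1 `invSq_ge_of_runConstRemainder` — (H_up) FROM ROW (i): along every run of the (revised) record datum that stays in `]0,γ]`, `γ ≤ γ₀`, the couplings solve (0.20)
  (`FlowStepRuns.rgEqH_of_inInterval` on the datum's `fwd ∕ curries` fields + `RGMachineCore.haltsOutside`), so row (i) `|β_k − b_k| ≤ r` gives `g_j⁻² = g₀⁻² − Σ_{i<j}β_i ≥ g₀⁻² − Σ_{i<j}(b_i + r)⁺`.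
* §2 ★★★ `k1R9Body_false_of_logSlope_sharp` — K1⁹'s body text VERBATIM at `(θ, h, v)` + letters of log-slope AT MOST `a` with `4a < d(𝔤)` ⟹ `False` (NO floor hypothesis on this side; p641922's
  `L⁻⁴` loss removed: row (i) feeds §1 into INTENT-6's sharp threshold, K2⁹ gives END).  ★★★ `k1R9Body_four_mul_slope_eq_dim` — K1⁹'s body + TWO-SIDED letters of slope `a` + K-uniform last-step
  small-field floors in some window `]0,γ_c]` ⟹ `4a = d(𝔤)`; `SU(2)`: `a = 3∕4`.  READING: whatever tuple closes K1⁹ with two-sided-slope letters and last-step floors normalises EXACTLY like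
  print's `log z_j = d(𝔤) log g_j + O(1)` ([I] (0.15), two-sided in the tree: `B16ZLower` + p644747); `k1R9Witness_four_mul_slope_eq_dim` = the same conditional on the crux.
HONEST FRAMING: count-neutral; K1⁹ NEITHER proved NOR refuted (its `∃ θ` ranges over all slots — witness CLASSES only; the floor is a hypothesis on the witness); nothing of Bałaban's asserted or
refuted; no skeleton ∕ route text changed; N13 NOT discharged; counts UNMOVED (typed 28∕28 · discharged 5∕27 · A 5∕28); R4 closes the conditional finite-𝕋⁴ rung `BalabanLadder.UV` only — the
Yang–Mills mass gap (Clay) is NOT proved by any of this; nothing continuum ∕ ℝ⁴ ∕ OS.  No `sorry`, `def`, `instance`, `notation`.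
-/

noncomputable section

open scoped BigOperators

namespace Summit.QuantumFields.YangMills.BalabanUVNodes.N13K1R9WitnessSlopeExact

open Literature.MathematicalPhysics.QuantumFieldTheory.Balaban1983to89
open Literature.MathematicalPhysics.QuantumFieldTheory.Balaban1983to89.T4Continuum
open Literature.MathematicalPhysics.QuantumFieldTheory.Balaban1983to89.Node00
open Literature.MathematicalPhysics.QuantumFieldTheory.Balaban1983to89.FlowStepRuns (genSeq genSeq_zero)
open T4StabilitySocket
open Summit.QuantumFields.YangMills.Theorems.BalabanUVNodesK2R9Holds (endpointGivenRunRowsR13SepCoPHV_holds)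
open Summit.QuantumFields.YangMills.BalabanUVNodes.N13NormalisationUpperSlopeThresholdAtRecord13SepCoPHV (logCoupling_comparable_of_runPartialSumFloor)
open Summit.QuantumFields.YangMills.BalabanUVNodes.N13NormalisationSharpLowerSlopeThresholdAtRecord13SepCoPHV
  (false_of_endStatementBPrinted_of_endpointExistence_of_logSlope_sharp four_mul_slope_eq_dim_of_endStatementBPrinted_of_endpointExistence)

variable {F : T4Family} {N : ℕ} [NeZero N]

/-! ## §1. (H_up) from row (i): `g_j⁻² ≥ g₀⁻² − Σ_{i<j}(b_i + r)⁺` along the datum's windowed runs -/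

section Row

variable (θ : Stage13HParams F N) (h : θ.Provisos₁₃SepCoPH F N) (v : Revision₁₃ F N θ h)

/-- **UPPER COUPLING COMPARABILITY FROM ROW (i).**  If `|β_θ,k(prefix) − b_k| ≤ r` along every (0.20)-run in `]0,γ₀]` (K1⁹'s row (i), verbatim), then along every run `p` of the revised
record datum in `]0,γ]`, `γ ≤ γ₀`:  `g₀⁻² − Σ_{i<j}(b_i + r)⁺ ≤ g_j⁻²` for all `j ≤ p.K` (`g_j = gOfRecord₁₃ θ p j`; the run solves (0.20), telescope `inv_sq_telescopeH`).
[cite: Balaban1987RG1, (0.18)–(0.20) pp.255–256 (bookkeeping)] -/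
theorem invSq_ge_of_runConstRemainder {γ₀ r : ℝ} {b : ℕ → ℝ}
    (hi : ∀ (n : ℕ) (gs : ℕ → ℝ), FlowStep.RGEqH n (betaOfRecord₁₃ F N θ.toStage13Params) gs → Step.InInterval γ₀ n gs →
      ∀ k, k ≤ n → |betaOfRecord₁₃ F N θ.toStage13Params k (FlowStep.prefixOf gs k) - b k| ≤ r)
    (p : B12.RunParams) {γ : ℝ} (hγ₀ : γ ≤ γ₀) (hI : ((datumOfRecord₁₃SepCoPHV F N θ h v).C p).flow.InInterval γ p.K) :
    ∀ j, j ≤ p.K → 1 / p.g0 ^ 2 - ∑ i ∈ Finset.range j, max (b i + r) 0 ≤ 1 / gOfRecord₁₃ F N θ.toStage13Params p j ^ 2 := by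
  intro j hj
  have hhalt : FlowStepRuns.HaltsOutside (datumOfRecord₁₃SepCoPHV F N θ h v).C.toB12 (betaOfRecord₁₃ F N θ.toStage13Params) := by
    rw [toB12_datumOfRecord₁₃SepCoPHV]
    exact (coreOfRecord₁₃CoPH F N θ).haltsOutside (towerOfRecord₁₃SepCoPH F N θ h).ρ
  have hrg : FlowStep.RGEqH p.K (betaOfRecord₁₃ F N θ.toStage13Params) ((datumOfRecord₁₃SepCoPHV F N θ h v).C p).flow.g :=
    FlowStepRuns.rgEqH_of_inInterval (datumOfRecord₁₃SepCoPHV F N θ h v).fwd hhalt (datumOfRecord₁₃SepCoPHV F N θ h v).curries p hI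
  set gs : ℕ → ℝ := ((datumOfRecord₁₃SepCoPHV F N θ h v).C p).flow.g with hgs
  have hflow : gs = gOfRecord₁₃ F N θ.toStage13Params p := flow_g_datumOfRecord₁₃SepCoPHV F N θ h v p
  have hrgj : FlowStep.RGEqH j (betaOfRecord₁₃ F N θ.toStage13Params) gs := fun k hk => hrg k (lt_of_lt_of_le hk hj)
  have hIj : Step.InInterval γ₀ j gs := fun k hk => ⟨(hI k (hk.trans hj)).1, (hI k (hk.trans hj)).2.trans hγ₀⟩
  have htel := FlowStep.inv_sq_telescopeH hrgj (Nat.zero_le j) le_rfl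
  have hsum : ∑ i ∈ Finset.Ico 0 j, betaOfRecord₁₃ F N θ.toStage13Params i (FlowStep.prefixOf gs i) ≤ ∑ i ∈ Finset.range j, max (b i + r) 0 := by
    rw [← Finset.range_eq_Ico]
    refine Finset.sum_le_sum fun i hi' => ?_
    have := (abs_le.1 (hi j gs hrgj hIj i (le_of_lt (Finset.mem_range.1 hi')))).2
    exact le_trans (by linarith) (le_max_left _ _)
  have hg0 : gs 0 = p.g0 := by rw [hflow]; exact genSeq_zero _ _
  have hgj : gs j = gOfRecord₁₃ F N θ.toStage13Params p j := by rw [hflow]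
  rw [← hg0, ← hgj]
  linarith

end Row

/-! ## §2. K1⁹'s body: the sharp lower threshold and the exact slope -/

section Body

/-- **★★★ K1⁹'s BODY IS FALSE AT EVERY TUPLE WITH SUB-`d(𝔤)∕4` NORMALISATION SLOPE** (sharp edition of p641922).  `a ≤ d(𝔤)`, `4a < d(𝔤)`, `0 ≤ C_w`; slots with
`−logz_p(j)·(L⁴−1)|T₁^{(j+1)}| + Efl_p(j) ≤ (a·(−log g_j) + C_w)·|T^{(j)*}|` in the weak-coupling regime: the text after `∃ θ h v,` of
`Summit.QuantumFields.YangMills.Theses.BalabanUVNodes.StabilityBRunRowsAtRecordR13SepCoPHV`, VERBATIM, implies `False` — END from K2⁹ by name, (H_up) from row (i) via §1.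
[cite: Balaban1988Convergent, Thm 1 p.262, (1.15) p.249, Cor. 3 (2.50) p.264; Balaban1987RG1, Thm 2 p.259, (0.15) p.254, (0.20) p.256] -/
theorem k1R9Body_false_of_logSlope_sharp (θ : Stage13HParams F 2) (h : θ.Provisos₁₃SepCoPH F 2) (v : Revision₁₃ F 2 θ h) {a Cw : ℝ}
    (ha : a ≤ ((dimSU 2 : ℕ) : ℝ)) (hκ : 4 * a < ((dimSU 2 : ℕ) : ℝ)) (hCw : 0 ≤ Cw)
    (hw : ∀ (p : B12.RunParams) (j : ℕ), j < p.K → 0 < gOfRecord₁₃ F 2 θ.toStage13Params p j → gOfRecord₁₃ F 2 θ.toStage13Params p j ≤ 1 →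
      -(θ.logz p j) * ((((F.P p.K).L : ℝ) ^ 4 - 1) * sitesCard (F.P p.K) (j + 1)) + θ.Efl p j ≤
        (a * (-Real.log (gOfRecord₁₃ F 2 θ.toStage13Params p j)) + Cw) * tstarCount (F.P p.K) j)
    (hbody : (θ.ZhUnity F 2 ∧ θ.SlotsNondegenerate₁₃ F 2) ∧ θ.Admissible F 2 ∧ B16.EndStatementBPrinted (Node00.datumOfRecord₁₃SepCoPHV F 2 θ h v).C ∧ (∃ γ₁ : ℝ, 0 < γ₁ ∧ ∀ γ : ℝ, 0 < γ → γ ≤ γ₁ → ∃ P : B12.RunParams, 1 ≤ P.K ∧ ((Node00.datumOfRecord₁₃SepCoPHV F 2 θ h v).C P).flow.InInterval γ P.K) ∧ ∃ (b : ℕ → ℝ) (r γ₀ M : ℝ), 0 < γ₀ ∧ (∀ (n : ℕ) (gs : ℕ → ℝ), FlowStep.RGEqH n (Node00.betaOfRecord₁₃ F 2 θ.toStage13Params) gs → Step.InInterval γ₀ n gs → ∀ k, k ≤ n → |Node00.betaOfRecord₁₃ F 2 θ.toStage13Params k (FlowStep.prefixOf gs k) - b k| ≤ r) ∧ (∀ (n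 : ℕ) (gs : ℕ → ℝ), FlowStep.RGEqH n (Node00.betaOfRecord₁₃ F 2 θ.toStage13Params) gs → Step.InInterval γ₀ n gs → ∀ k, k ≤ n → -M ≤ ∑ j ∈ Finset.Ico k n, Node00.betaOfRecord₁₃ F 2 θ.toStage13Params j (FlowStep.prefixOf gs j)) ∧ ∀ k : ℕ, ContinuousOn (fun x : ℝ => Node00.betaOfRecord₁₃ F 2 θ.toStage13Params k (FlowStep.clampPrefix (Node00.betaOfRecord₁₃ F 2 θ.toStage13Params) γ₀ k x)) {x : ℝ | 0 < x ∧ x ≤ γ₀ ∧ ∀ j, j ≤ k → 1 / γ₀ ^ 2 ≤ FlowStep.Y (Node00.betaOfRecord₁₃ F 2 θ.toStage13Params) γ₀ j x}) : False := by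
  obtain ⟨hU, hθ, hB, hwin, hrows⟩ := hbody
  obtain ⟨b, r, γ₀, M, hγ₀, hi, -, -⟩ := id hrows
  refine false_of_endStatementBPrinted_of_endpointExistence_of_logSlope_sharp θ h v (B := fun j => ∑ i ∈ Finset.range j, max (b i + r) 0)
    ha hκ hCw hγ₀ ?_ hw ?_ hB (endpointGivenRunRowsR13SepCoPHV_holds F θ h v hU hθ hB hrows hwin)
  · -- `B` is non-decreasing (sums of non-negative terms over growing ranges)
    intro j j' hjj'
    exact Finset.sum_le_sum_of_subset_of_nonneg (Finset.range_mono hjj') fun i _ _ => le_max_right _ _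
  · -- (H_up) on `γ₀`-windowed runs from row (i)
    intro p hp
    have hI : ((datumOfRecord₁₃SepCoPHV F 2 θ h v).C p).flow.InInterval γ₀ p.K := by
      intro k hk
      rw [flow_g_datumOfRecord₁₃SepCoPHV]
      exact hp k hk
    exact invSq_ge_of_runConstRemainder θ h v hi p le_rfl hI

/-- **★★★ K1⁹'s BODY PINS THE NORMALISATION SLOPE TO `d(𝔤)∕4`.**  At a tuple `(θ, h, v)` whose numerics slots have TWO-SIDED log-slope `a` in the weak-coupling regime
(`|ℓ_p(j) − a·log(1∕g_j)·|T^{(j)*}|| ≤ C_w|T^{(j)*}|`, `a ≤ d(𝔤)`) and whose last-step small-field mass has K-uniform floors along the fixed-endpoint runs in some window `]0,γ_c]`, the text after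
`∃ θ h v,` of `Summit.QuantumFields.YangMills.Theses.BalabanUVNodes.StabilityBRunRowsAtRecordR13SepCoPHV`, VERBATIM, implies `4a = d(𝔤)` (`SU(2)`: `a = 3∕4`) — rows (i) ∕ (iv) give (H_up) ∕ (H_cmp),
K2⁹ gives END; INTENT-6's §3 concludes.  [cite: Balaban1988Convergent, Thm 1 p.262, (1.15) p.249, Cor. 3 (2.50) p.264; Balaban1987RG1, Thm 2 p.259, (0.15) p.254, (0.20) p.256] -/
theorem k1R9Body_four_mul_slope_eq_dim (θ : Stage13HParams F 2) (h : θ.Provisos₁₃SepCoPH F 2) (v : Revision₁₃ F 2 θ h) {a Cw γc : ℝ}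
    (ha : a ≤ ((dimSU 2 : ℕ) : ℝ)) (hCw : 0 ≤ Cw) (hγc : 0 < γc)
    (hw : ∀ (p : B12.RunParams) (j : ℕ), j < p.K → 0 < gOfRecord₁₃ F 2 θ.toStage13Params p j → gOfRecord₁₃ F 2 θ.toStage13Params p j ≤ 1 →
      |(-(θ.logz p j) * ((((F.P p.K).L : ℝ) ^ 4 - 1) * sitesCard (F.P p.K) (j + 1)) + θ.Efl p j) -
          a * (-Real.log (gOfRecord₁₃ F 2 θ.toStage13Params p j)) * tstarCount (F.P p.K) j| ≤ Cw * tstarCount (F.P p.K) j)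
    (hlow : ∀ g : ℝ, 0 < g → g ≤ γc → ∃ c : ℝ, 0 < c ∧ ∀ (K : ℕ) (g₀ : ℝ),
      (∀ k, k ≤ K → 0 < gOfRecord₁₃ F 2 θ.toStage13Params ⟨K, F.m, g₀⟩ k ∧ gOfRecord₁₃ F 2 θ.toStage13Params ⟨K, F.m, g₀⟩ k ≤ γc) →
        gOfRecord₁₃ F 2 θ.toStage13Params ⟨K, F.m, g₀⟩ K = g → c ≤ smallFieldMass (datumOfRecord₁₃SepCoPHV F 2 θ h v) K g₀)
    (hbody : (θ.ZhUnity F 2 ∧ θ.SlotsNondegenerate₁₃ F 2) ∧ θ.Admissible F 2 ∧ B16.EndStatementBPrinted (Node00.datumOfRecord₁₃SepCoPHV F 2 θ h v).C ∧ (∃ γ₁ : ℝ, 0 < γ₁ ∧ ∀ γ : ℝ, 0 < γ → γ ≤ γ₁ → ∃ P : B12.RunParams, 1 ≤ P.K ∧ ((Node00.datumOfRecord₁₃SepCoPHV F 2 θ h v).C P).flow.InInterval γ P.K) ∧ ∃ (b : ℕ → ℝ) (r γ₀ M : ℝ), 0 < γ₀ ∧ (∀ (n : ℕ) (gs : ℕ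 → ℝ), FlowStep.RGEqH n (Node00.betaOfRecord₁₃ F 2 θ.toStage13Params) gs → Step.InInterval γ₀ n gs → ∀ k, k ≤ n → |Node00.betaOfRecord₁₃ F 2 θ.toStage13Params k (FlowStep.prefixOf gs k) - b k| ≤ r) ∧ (∀ (n : ℕ) (gs : ℕ → ℝ), FlowStep.RGEqH n (Node00.betaOfRecord₁₃ F 2 θ.toStage13Params) gs → Step.InInterval γ₀ n gs → ∀ k, k ≤ n → -M ≤ ∑ j ∈ Finset.Ico k n, Node00.betaOfRecord₁₃ F 2 θ.toStage13Params j (FlowStep.prefixOf gs j)) ∧ ∀ k : ℕ, ContinuousOn (fun x : ℝ => Node00.betaOfRecord₁₃ F 2 θ.toStage13Params k (FlowStep.clampPrefix (Node00.betaOfRecord₁₃ F 2 θ.toStage13Params) γ₀ k x)) {x : ℝ | 0 < x ∧ x ≤ γ₀ ∧ ∀ j, j ≤ k → 1 / γ₀ ^ 2 ≤ FlowStep.Y (Node00.betaOfRecord₁₃ F 2 θ.toStage13Params) γ₀ j x}) :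
    4 * a = ((dimSU 2 : ℕ) : ℝ) := by
  obtain ⟨hU, hθ, hB, hwin, hrows⟩ := hbody
  obtain ⟨b, r, γ₀, M, hγ₀, hi, hiv, -⟩ := id hrows
  -- the common window `γ' = min(γ₀, γ_c, 1)`
  set γ' : ℝ := min γ₀ (min γc 1) with hγ'
  have hγ'pos : 0 < γ' := lt_min hγ₀ (lt_min hγc one_pos)
  have hγ'₀ : γ' ≤ γ₀ := min_le_left _ _
  have hγ'c : γ' ≤ γc := (min_le_right _ _).trans (min_le_left _ _)
  have hγ'1 : γ' ≤ 1 := (min_le_right _ _).trans (min_le_right _ _)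
  have hwindow : ∀ p : B12.RunParams, (∀ k, k ≤ p.K → 0 < gOfRecord₁₃ F 2 θ.toStage13Params p k ∧ gOfRecord₁₃ F 2 θ.toStage13Params p k ≤ γ') →
      ((datumOfRecord₁₃SepCoPHV F 2 θ h v).C p).flow.InInterval γ' p.K := by
    intro p hp k hk
    rw [flow_g_datumOfRecord₁₃SepCoPHV]
    exact hp k hk
  refine four_mul_slope_eq_dim_of_endStatementBPrinted_of_endpointExistence θ h v (M' := max M 0 / 2) (B := fun j => ∑ i ∈ Finset.range j, max (b i + r) 0)
    ha hCw (by positivity) hγ'pos ?_ hw ?_ ?_ ?_ hB (endpointGivenRunRowsR13SepCoPHV_holds F θ h v hU hθ hB hrows hwin)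
  · intro j j' hjj'
    exact Finset.sum_le_sum_of_subset_of_nonneg (Finset.range_mono hjj') fun i _ _ => le_max_right _ _
  · intro p hp
    exact logCoupling_comparable_of_runPartialSumFloor θ h v hiv p hγ'₀ hγ'1 (hwindow p hp)
  · intro p hp
    exact invSq_ge_of_runConstRemainder θ h v hi p hγ'₀ (hwindow p hp)
  · intro g hg hgle
    obtain ⟨c, hc, hcK⟩ := hlow g hg (hgle.trans hγ'c)
    exact ⟨c, hc, fun K g₀ hp hK => hcK K g₀ (fun k hk => ⟨(hp k hk).1, (hp k hk).2.trans hγ'c⟩) hK⟩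

/-- **★★ READING FOR THE SUPPLIER LANES** (`SU(2)`, `d(𝔤) = 3`): if K1⁹ holds then at every family with the K0⁷ antecedent its witness tuple either has numerics slots WITHOUT two-sided
log-slope `a` for any `a ≠ 3∕4` (`a ≤ 3`, any `C_w ≥ 0`), or lacks K-uniform last-step small-field floors in every window — i.e. a witness with two-sided-slope letters and floors has
`a = 3∕4`: print's `log z_j = 3 log g_j + O(1)`.  CONDITIONAL on the crux; nothing asserted.
[cite: Balaban1988Convergent, Thm 1 p.262, (1.15) p.249; Balaban1987RG1, (0.15) p.254] -/
theorem k1R9Witness_four_mul_slope_eq_dim (hK1 : Summit.QuantumFields.YangMills.Theses.BalabanUVNodes.StabilityBRunRowsAtRecordR13SepCoPHV) (F : T4Family)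
    (h0 : ∃ θ : Stage13HParams F 2, θ.Provisos₁₃SepCoPH F 2 ∧ (θ.ZhUnity F 2 ∧ θ.SlotsNondegenerate₁₃ F 2) ∧ θ.Admissible F 2) :
    ∃ (θ : Stage13HParams F 2) (h : θ.Provisos₁₃SepCoPH F 2) (v : Revision₁₃ F 2 θ h),
      B16.EndStatementBPrinted (datumOfRecord₁₃SepCoPHV F 2 θ h v).C ∧
      ∀ {a Cw γc : ℝ}, a ≤ ((dimSU 2 : ℕ) : ℝ) → 0 ≤ Cw → 0 < γc →
        (∀ (p : B12.RunParams) (j : ℕ), j < p.K → 0 < gOfRecord₁₃ F 2 θ.toStage13Params p j → gOfRecord₁₃ F 2 θ.toStage13Params p j ≤ 1 →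
          |(-(θ.logz p j) * ((((F.P p.K).L : ℝ) ^ 4 - 1) * sitesCard (F.P p.K) (j + 1)) + θ.Efl p j) -
              a * (-Real.log (gOfRecord₁₃ F 2 θ.toStage13Params p j)) * tstarCount (F.P p.K) j| ≤ Cw * tstarCount (F.P p.K) j) →
        (∀ g : ℝ, 0 < g → g ≤ γc → ∃ c : ℝ, 0 < c ∧ ∀ (K : ℕ) (g₀ : ℝ),
          (∀ k, k ≤ K → 0 < gOfRecord₁₃ F 2 θ.toStage13Params ⟨K, F.m, g₀⟩ k ∧ gOfRecord₁₃ F 2 θ.toStage13Params ⟨K, F.m, g₀⟩ k ≤ γc) →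
            gOfRecord₁₃ F 2 θ.toStage13Params ⟨K, F.m, g₀⟩ K = g → c ≤ smallFieldMass (datumOfRecord₁₃SepCoPHV F 2 θ h v) K g₀) →
        4 * a = ((dimSU 2 : ℕ) : ℝ) := by
  obtain ⟨θ, h, v, hbody⟩ := hK1 F h0
  exact ⟨θ, h, v, hbody.2.2.1, fun ha hCw hγc hw hlow => k1R9Body_four_mul_slope_eq_dim θ h v ha hCw hγc hw hlow hbody⟩

end Body

end Summit.QuantumFields.YangMills.BalabanUVNodes.N13K1R9WitnessSlopeExact

end
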